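import Literature.NumberTheory.EllipticCurves.PoonenRainsTransport
import Literature.NumberTheory.EllipticCurves.TwoAdicImageSurjectivityModTwoProofs
import Literature.NumberTheory.EllipticCurves.QuadraticTwist
import HarnessLib

/-!
# The Poonen–Rains form of a quadratic twist: the `2`-torsion identification and `q_{E} ∘ H¹(f) = q_{E'}`

For elliptic `W, W'` over `K` (`2 ≠ 0`) with `C • W' = W.quadraticTwist d` (`W'` a model of the quadratic twist
`E^d`, `C = (u, r, s, t)`), the `2`-torsion abscissae are affinely related over `K`:
`x'_j = u² d · x_{πj} + r` (the `2`-division cubics satisfy `Ψ_{W'}(u²dX + r) = u⁶d³ Ψ_W(X)`), so the frames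
give a CANONICAL `Γ_K`-equivariant identification `twistTorsionMap : E'[2] →ⁱL E[2]`, `T'_j ↦ T_{πj}`
(injective), to which the transport theorem `prClass_map_eq` (KMR Lemma 5.2) applies:

  `prClass W h2 L (H¹(twistTorsionMap|_L) x') = prClass W' h2 L x'`   (`prClass_map_twistTorsionMap`).

References: [KlagsbrunMazurRubin2013] Lemma 5.2; [SilvermanAEC2009] III.1 Table 3.1, X.§5 (twists);
[PoonenRains2012] §4.  No named fact is introduced.
-/

set_option autoImplicit false

noncomputable section

open scoped Classical ContRepresentation

namespace Literature.NumberTheory.EllipticCurves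

namespace ThetaLevelTwo

open _root_.WeierstrassCurve Field
open Literature.NumberTheory.GaloisRepresentations Literature.NumberTheory.GaloisRepresentations.DiscreteGaloisModule
open Literature.NumberTheory.EllipticCurves.DokchitserDokchitser2012 (vec idx frame T xT permGal T_permGal smul_xT
  xT_injective coe_T_ne_zero eq_zero_or_eq_T T_injective roots_twoTorsionPolynomial)

universe u

/-! ### The linear self-map of `𝔽₂²` attached to an injective self-map of the three nonzero vectors -/

/-- `v ↦ v_{π(idx v)}` (`0 ↦ 0`). [cite: SilvermanAEC2009, III.§7 (E[2] ≅ (ℤ/2)²)] -/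
def permVFun (π : Fin 3 → Fin 3) (v : V) : V := if v = 0 then 0 else vec (π (idx v))

/-- For injective `π` the map `permVFun π` is additive (any permutation of the nonzero vectors of `𝔽₂²` is linear).
[cite: SilvermanAEC2009, III.§7 (E[2] ≅ (ℤ/2)²)] -/
theorem permVFun_add : ∀ (π : Fin 3 → Fin 3), Function.Injective π → ∀ v w : V,
    permVFun π (v + w) = permVFun π v + permVFun π w := by
  unfold permVFun; decide

/-- `permVFun π` as an additive monoid homomorphism. [cite: SilvermanAEC2009, III.§7 (E[2] ≅ (ℤ/2)²)] -/
def permV (π : Fin 3 → Fin 3) (hπ : Function.Injective π) : V →+ V where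
  toFun := permVFun π
  map_zero' := by simp [permVFun]
  map_add' := permVFun_add π hπ

/-- `permV π vⱼ = v_{πj}`. [cite: SilvermanAEC2009, III.§7 (E[2] ≅ (ℤ/2)²)] -/
@[simp] theorem permV_vec (π : Fin 3 → Fin 3) (hπ : Function.Injective π) (j : Fin 3) :
    permV π hπ (vec j) = vec (π j) := by
  have hidx : idx (vec j) = j := by fin_cases j <;> decide
  simp [permV, permVFun, hidx, show vec j ≠ 0 by fin_cases j <;> decide]

variable {K : Type u} [Field K] (W W' : WeierstrassCurve K) [W.IsElliptic] [W'.IsElliptic] (h2 : (2 : K) ≠ 0)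

/-! ### The `2`-division cubic and its roots -/

/-- The `2`-division cubic `Ψ_V(z) = 4z³ + b₂z² + 2b₄z + b₆` evaluated in `K̄`. [cite: SilvermanAEC2009, III.§1 (the 2-division polynomial)] -/
def psi (V : WeierstrassCurve K) (z : AlgebraicClosure K) : AlgebraicClosure K :=
  4 * z ^ 3 + algebraMap K _ V.b₂ * z ^ 2 + 2 * algebraMap K _ V.b₄ * z + algebraMap K _ V.b₆

/-- **The roots of `Ψ_W` in `K̄` are exactly the abscissae `x₀, x₁, x₂` of the frame.**
[cite: SilvermanAEC2009, Ex. III.3.7 (d) (roots of ψ₂² are the abscissae of E[2] ∖ O)] -/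
theorem psi_eq_zero_iff (z : AlgebraicClosure K) : psi W z = 0 ↔ ∃ i : Fin 3, z = xT W h2 i := by
  have ha : (Cubic.map (algebraMap K (AlgebraicClosure K)) W.twoTorsionPolynomial).a ≠ 0 := by
    change algebraMap K (AlgebraicClosure K) 4 ≠ 0
    rw [map_ne_zero, show (4 : K) = 2 ^ 2 by norm_num]; exact pow_ne_zero 2 h2
  have hne := Cubic.ne_zero_of_a_ne_zero ha
  have hroot : psi W z = 0 ↔ z ∈ (Cubic.map (algebraMap K (AlgebraicClosure K)) W.twoTorsionPolynomial).roots := by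
    rw [Cubic.mem_roots_iff hne]
    simp only [Cubic.map, twoTorsionPolynomial, map_ofNat, map_mul, psi]
  rw [hroot, roots_twoTorsionPolynomial W h2]
  simp only [Multiset.insert_eq_cons, Multiset.mem_cons, Multiset.mem_singleton]
  constructor
  · rintro (h | h | h) <;> exact ⟨_, h⟩
  · rintro ⟨i, rfl⟩
    fin_cases i
    · exact Or.inl rfl
    · exact Or.inr (Or.inl rfl)
    · exact Or.inr (Or.inr rfl)

section Twist

variable (d : K) (C : VariableChange K) (hC : C • W' = W.quadraticTwist d)

omit [W.IsElliptic] [W'.IsElliptic] in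
include h2 hC in
/-- **`Ψ_{W'}(u²d·X + r) = u⁶d³·Ψ_W(X)`** for `C • W' = W^d`, `C = (u, r, s, t)` (Silverman III.1 Table 3.1 for the
`b`-invariants under a change of variables, and `b₂, b₄, b₆ ↦ d b₂, d² b₄, d³ b₆` under the twist).
[cite: SilvermanAEC2009, III.1 Table 3.1 (b-invariants under a change of variables)] -/
theorem psi_twist (X : AlgebraicClosure K) :
    psi W' (algebraMap K _ ((C.u : K) ^ 2 * d) * X + algebraMap K _ C.r)
      = algebraMap K _ ((C.u : K) ^ 6 * d ^ 3) * psi W X := by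
  haveI : NeZero (2 : K) := ⟨h2⟩
  have hb2 := congrArg WeierstrassCurve.b₂ hC
  have hb4 := congrArg WeierstrassCurve.b₄ hC
  have hb6 := congrArg WeierstrassCurve.b₆ hC
  rw [variableChange_b₂, quadraticTwist_b₂] at hb2
  rw [variableChange_b₄, quadraticTwist_b₄] at hb4
  rw [variableChange_b₆, quadraticTwist_b₆] at hb6
  have hu : (C.u : K) ≠ 0 := C.u.ne_zero
  rw [Units.val_inv_eq_inv_val] at hb2 hb4 hb6
  -- solve for the invariants of `W'`
  have hb2' : W'.b₂ = (C.u : K) ^ 2 * d * W.b₂ - 12 * C.r := by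
    field_simp at hb2; linear_combination hb2
  have hb4' : W'.b₄ = (C.u : K) ^ 4 * d ^ 2 * W.b₄ - C.r * W'.b₂ - 6 * C.r ^ 2 := by
    field_simp at hb4; linear_combination hb4
  have hb6' : W'.b₆ = (C.u : K) ^ 6 * d ^ 3 * W.b₆ - 2 * C.r * W'.b₄ - C.r ^ 2 * W'.b₂ - 4 * C.r ^ 3 := by
    field_simp at hb6; linear_combination hb6
  have e2 := congrArg (algebraMap K (AlgebraicClosure K)) hb2'
  have e4 := congrArg (algebraMap K (AlgebraicClosure K)) hb4'
  have e6 := congrArg (algebraMap K (AlgebraicClosure K)) hb6'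
  simp only [map_sub, map_mul, map_pow, map_ofNat] at e2 e4 e6
  simp only [psi, map_mul, map_pow]
  set U := algebraMap K (AlgebraicClosure K) (C.u : K)
  set R := algebraMap K (AlgebraicClosure K) C.r
  set D := algebraMap K (AlgebraicClosure K) d
  linear_combination (U ^ 2 * D * X) ^ 2 * e2 + 2 * (U ^ 2 * D * X) * e4 + e6

variable (hd : ∀ x : K, x ^ 2 ≠ d)

include hC hd in
/-- Each abscissa `x'_j` of `W'` is `u²d·x_i + r` for a (unique) abscissa `x_i` of `W`.
[cite: SilvermanAEC2009, X.§5 (quadratic twists)] -/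
theorem exists_xT_twist (j : Fin 3) : ∃ i : Fin 3,
    xT W' h2 j = algebraMap K _ ((C.u : K) ^ 2 * d) * xT W h2 i + algebraMap K _ C.r := by
  have hd0 : d ≠ 0 := fun h => hd 0 (by rw [h]; ring)
  have hA : algebraMap K (AlgebraicClosure K) ((C.u : K) ^ 2 * d) ≠ 0 := by
    rw [map_ne_zero]; exact mul_ne_zero (pow_ne_zero 2 C.u.ne_zero) hd0
  set X := (xT W' h2 j - algebraMap K _ C.r) / algebraMap K _ ((C.u : K) ^ 2 * d) with hX
  have hz : algebraMap K _ ((C.u : K) ^ 2 * d) * X + algebraMap K _ C.r = xT W' h2 j := by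
    rw [hX]; field_simp; ring
  have hroot : psi W X = 0 := by
    have h0 : psi W' (xT W' h2 j) = 0 := (psi_eq_zero_iff W' h2 _).mpr ⟨j, rfl⟩
    rw [← hz, psi_twist W W' h2 d C hC] at h0
    rcases mul_eq_zero.mp h0 with h | h
    · rw [map_eq_zero] at h
      exact absurd h (mul_ne_zero (pow_ne_zero 6 C.u.ne_zero) (pow_ne_zero 3 hd0))
    · exact h
  obtain ⟨i, hi⟩ := (psi_eq_zero_iff W h2 X).mp hroot
  exact ⟨i, by rw [← hz, hi]⟩

/-- The index map `π` of the twist: `x'_j = u²d·x_{πj} + r`. [cite: SilvermanAEC2009, X.§5 (quadratic twists)] -/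
def twistPerm (j : Fin 3) : Fin 3 := Classical.choose (exists_xT_twist W W' h2 d C hC hd j)

/-- Defining property of `twistPerm`. [cite: SilvermanAEC2009, X.§5 (quadratic twists)] -/
theorem xT_twistPerm (j : Fin 3) :
    xT W' h2 j = algebraMap K _ ((C.u : K) ^ 2 * d) * xT W h2 (twistPerm W W' h2 d C hC hd j) + algebraMap K _ C.r :=
  Classical.choose_spec (exists_xT_twist W W' h2 d C hC hd j)

/-- The affine relation of abscissae: `x'_i − x'_j = u²d·(x_{πi} − x_{πj})`. [cite: SilvermanAEC2009, X.§5 (quadratic twists)] -/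
theorem xT_sub_xT_twist (i j : Fin 3) :
    xT W' h2 i - xT W' h2 j = algebraMap K _ ((C.u : K) ^ 2 * d)
      * (xT W h2 (twistPerm W W' h2 d C hC hd i) - xT W h2 (twistPerm W W' h2 d C hC hd j)) := by
  rw [xT_twistPerm W W' h2 d C hC hd i, xT_twistPerm W W' h2 d C hC hd j]; ring

/-- `π` is injective. [cite: SilvermanAEC2009, X.§5 (quadratic twists)] -/
theorem twistPerm_injective : Function.Injective (twistPerm W W' h2 d C hC hd) :=
  π_injective W W' h2 _ _ (xT_sub_xT_twist W W' h2 d C hC hd)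

/-- `π` commutes with the Galois permutations: `π(σ·j) = σ·(πj)` (the relation `x' = u²d x + r` is defined over `K`).
[cite: SilvermanAEC2009, VIII.§1 (Galois acts coordinatewise)] -/
theorem twistPerm_permGal (σ : absoluteGaloisGroup K) (j : Fin 3) :
    twistPerm W W' h2 d C hC hd (permGal W' h2 σ j) = permGal W h2 σ (twistPerm W W' h2 d C hC hd j) := by
  have hd0 : d ≠ 0 := fun h => hd 0 (by rw [h]; ring)
  have hA : algebraMap K (AlgebraicClosure K) ((C.u : K) ^ 2 * d) ≠ 0 := by
    rw [map_ne_zero]; exact mul_ne_zero (pow_ne_zero 2 C.u.ne_zero) hd0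
  apply xT_injective W h2
  have h1 := xT_twistPerm W W' h2 d C hC hd (permGal W' h2 σ j)
  have h2' := congrArg (fun z => σ • z) (xT_twistPerm W W' h2 d C hC hd j)
  simp only [smul_add, smul_mul', smul_xT] at h2'
  rw [show σ • algebraMap K (AlgebraicClosure K) ((C.u : K) ^ 2 * d) = algebraMap K _ ((C.u : K) ^ 2 * d) from
      (show AlgebraicClosure K ≃ₐ[K] AlgebraicClosure K from σ).commutes _,
    show σ • algebraMap K (AlgebraicClosure K) C.r = algebraMap K _ C.r from
      (show AlgebraicClosure K ≃ₐ[K] AlgebraicClosure K from σ).commutes _] at h2'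
  rw [h1] at h2'
  exact mul_left_cancel₀ hA (add_right_cancel h2')

/-! ### The identification `E'[2] → E[2]` -/

/-- The additive map `E'[2] → E[2]`, `T'_j ↦ T_{πj}` (through the frames). [cite: KlagsbrunMazurRubin2013, Lemma 5.2 (E[2] = E^χ[2])] -/
def twistTorsionHom : geomTorsion W' 2 →+ geomTorsion W 2 :=
  ((frame W h2).symm.toAddMonoidHom.comp (permV _ (twistPerm_injective W W' h2 d C hC hd))).comp
    (frame W' h2).toAddMonoidHom

/-- `twistTorsionHom T'_j = T_{πj}`. [cite: KlagsbrunMazurRubin2013, Lemma 5.2 (E[2] = E^χ[2])] -/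
theorem twistTorsionHom_T (j : Fin 3) :
    twistTorsionHom W W' h2 d C hC hd (T W' h2 j) = T W h2 (twistPerm W W' h2 d C hC hd j) := by
  simp only [twistTorsionHom, AddMonoidHom.coe_comp, AddEquiv.coe_toAddMonoidHom, Function.comp_apply, frame_T,
    permV_vec]
  rfl

/-- `twistTorsionHom` is `Γ_K`-equivariant. [cite: KlagsbrunMazurRubin2013, Lemma 5.2 (E[2] = E^χ[2] as Galois modules)] -/
theorem twistTorsionHom_smul (σ : absoluteGaloisGroup K) (P : geomTorsion W' 2) :
    twistTorsionHom W W' h2 d C hC hd (σ • P) = σ • twistTorsionHom W W' h2 d C hC hd P := by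
  rcases eq_zero_or_eq_T W' h2 P with rfl | ⟨j, rfl⟩
  · rw [smul_zero, map_zero, smul_zero]
  · rw [← T_permGal, twistTorsionHom_T, twistTorsionHom_T, twistPerm_permGal, T_permGal]

/-- `twistTorsionHom` is injective. [cite: KlagsbrunMazurRubin2013, Lemma 5.2 (E[2] = E^χ[2])] -/
theorem twistTorsionHom_injective : Function.Injective (twistTorsionHom W W' h2 d C hC hd) := by
  rw [injective_iff_map_eq_zero]
  intro P hP
  rcases eq_zero_or_eq_T W' h2 P with rfl | ⟨j, rfl⟩
  · rfl
  · rw [twistTorsionHom_T] at hP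
    exact absurd (congrArg (fun Q : geomTorsion W 2 => (Q : geomPoints W)) hP) (coe_T_ne_zero W h2 _)

/-- **The identification `E'[2] →ⁱL E[2]` of a quadratic twist** as a continuous `Γ_K`-intertwining map.
[cite: KlagsbrunMazurRubin2013, Lemma 5.2 (E[2] = E^χ[2] as Galois modules)] -/
def twistTorsionMap : (W'.torsionGaloisModule 2).toContRepresentation →ⁱL (W.torsionGaloisModule 2).toContRepresentation where
  toContinuousLinearMap := ⟨(twistTorsionHom W W' h2 d C hC hd).toIntLinearMap, continuous_of_discreteTopology⟩
  isIntertwining' σ := by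
    refine ContinuousLinearMap.ext fun P => ?_
    exact twistTorsionHom_smul W W' h2 d C hC hd σ P

/-- Values of `twistTorsionMap`. [cite: KlagsbrunMazurRubin2013, Lemma 5.2 (E[2] = E^χ[2])] -/
@[simp] theorem twistTorsionMap_apply (P : geomTorsion W' 2) :
    twistTorsionMap W W' h2 d C hC hd P = twistTorsionHom W W' h2 d C hC hd P := rfl

/-- `twistTorsionMap` is injective. [cite: KlagsbrunMazurRubin2013, Lemma 5.2 (E[2] = E^χ[2])] -/
theorem twistTorsionMap_injective : Function.Injective (twistTorsionMap W W' h2 d C hC hd) :=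
  twistTorsionHom_injective W W' h2 d C hC hd

/-- **The Poonen–Rains forms of `E` and of its quadratic twist agree under `E'[2] ≅ E[2]`** (KMR Lemma 5.2):
`prClass W h2 L (H¹(f|_L) x') = prClass W' h2 L x'` for `f = twistTorsionMap`, every `K`-field `L`.
[cite: KlagsbrunMazurRubin2013, Lemma 5.2 (the Tate quadratic forms of E and E^χ agree)] -/
theorem prClass_map_twistTorsionMap (L : Type u) [Field L] [Algebra K L]
    (x' : galoisCohomology (GaloisRep.restrictField L (W'.torsionGaloisModule 2)) 1) :
    prClass W h2 L (galoisCohomology.map ((twistTorsionMap W W' h2 d C hC hd).restrictField L) 1 x')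
      = prClass W' h2 L x' :=
  prClass_map_eq W W' h2 (twistTorsionMap W W' h2 d C hC hd) (twistPerm W W' h2 d C hC hd)
    (fun j => twistTorsionHom_T W W' h2 d C hC hd j) ((C.u : K) ^ 2 * d) (xT_sub_xT_twist W W' h2 d C hC hd) L x'

end Twist

end ThetaLevelTwo

end Literature.NumberTheory.EllipticCurves
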